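import Summits.BirchSwinnertonDyer.Rank1Residual.SecondDescent.BSDpFromSecondDescentEmpty
import HarnessLib

/-!
# Second-descent verdicts are ALL-OR-NOTHING under the exact count — the kernel form of
# instrument B-1's anomaly rule (cell `b2b-bsdres`, CLASS-CLOSURE instrument B-1 `SEL3CT-ALT`,
# seat cc-eng-4, GEN 12)

HONEST FRAMING (cell `b2b-bsdres`, run/shared/lean/b2b/bsd-rank1-residual/, verbatim in every
file): the goal of the cell is to DELETE the COMBINATION-SHAPED residual classes of the
Birch–Swinnerton-Dyer formula for ALL analytic-rank `≤ 1` elliptic curves over `ℚ` — "full BSD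
formula for every rank `≤ 1` curve in class `C`" assembled STRICTLY from published theorems — so
that the rank-`≤ 1` remainder becomes exactly the CONSTRUCTION-SHAPED classes, which are TYPED
(missing-input `Prop`s), NOT attempted. This is not "finishing BSD". This file is a class-free TOOL
file (finite-abelian-group algebra + the tree's Cassels–Tate pairing fact + the tree's descent
count), a CONSISTENCY statement about certificate-shaped hypotheses; it proves `False` from an
inconsistent SET of per-pair binders and `BSDp` of nothing; it books nothing, moves no mark, and
is not a Literature fact. THEOREMS ONLY (no definition, no named fact, no `sorry`).

## What this file does

Instrument B-1 (Creutz, *Second p-descents on elliptic curves*, Math. Comp. 83 (2014), `p = 3`)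
returns, per plane cubic `C` representing a non-zero class `c ∈ Ш(E/ℚ)[p]`, either `EMPTY`
(`c ∉ pШ`, the binder `hndiv : ∀ d, p • d ≠ c` of `ShaExponentFromNonDivisible.lean` /
`BSDpFromSecondDescentEmpty.lean` / `EmptyRecordsThree01–02.lean`) or `NONEMPTY(witness)`
(`c = p • d`, the binders `hc₁ : c₁ ≠ 0`, `hd : p • d = c₁` of `BSDpFromSecondDescentOneNonempty.lean`
/ `OneNonemptyRecordShapes.lean`). The lane's operating rule (eng-4 README ⟦GEN 11⟧, RUNBOOK §5)
calls a MIXED outcome — `EMPTY` on one class and `NONEMPTY` on another class of the same curve —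
an ANOMALY. This file states exactly when MIXED is a kernel CONTRADICTION and when it is not:

* `not_divisible_of_not_divisible_of_alternating` (§1, any finite abelian group `A` with an
  alternating bi-additive pairing of trivial kernel, any prime `p`, `#A[p] = p²`): if ONE
  `p`-torsion class is not a `p`-th multiple then NO non-zero `p`-torsion class is
  (divisibility by `p` is all-or-nothing on `A[p] ∖ {0}`); `false_of_mixed_of_alternating`: an
  `EMPTY` class and a non-zero `NONEMPTY` class cannot coexist. One line from
  `nsmul_eq_zero_of_sq_nsmul_eq_zero_of_alternating` (`A[p²] = A[p]`): a witness `d` with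
  `p • d = c₁`, `p • c₁ = 0` lies in `A[p²] = A[p]`, so `c₁ = p • d = 0`.
* §2, `Ш(E/K)` over a number field with `exists_casselsTate_pairing` (Silverman *AEC* X.4.14, the
  tree's named fact, kernel = divisible elements = `⊥` for finite `Ш`):
  `WeierstrassCurve.sha_not_divisible_of_casselsTate_of_not_divisible`,
  `WeierstrassCurve.false_of_sha_mixed_of_casselsTate`.
* §3, `E/ℚ`, analytic rank `≤ 1`, in the EXACT binders of the `EMPTY` consumers of
  `BSDpFromSecondDescentEmpty.lean` (GZK `hGZK`, CT `hCT`, `#E(ℚ)[p] = b` or irr(`p`), ONE complete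
  descent count `#Sel^(p)(E/ℚ) = p^(r_an) · b · p²`): every non-zero `p`-torsion class of `Ш` is
  `EMPTY` as soon as one is (`sha_forall_not_divisible_of_card_selmer_…`), and
  `EMPTY` + `NONEMPTY` ⇒ `False` (`false_of_card_selmer_…_of_mixed`, `false_of_irr_…_of_mixed`);
  §4 the `p = 3` shapes matching the record files: rank zero / irr(3) / `#Sel₃ = 9`
  (`Three.false_rankZero_of_card_selmerThree_eq_nine_of_casselsTate_of_mixed` — the binders of
  `bsdp3_b1e_·` plus one `NONEMPTY` witness) and rank one / `IsX11Three` / `#Sel₃ = 27`.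

## What it is worth to the instrument (EVIDENCE bookkeeping; nothing booked)

(a) PREDICTION (falsifiable, pre-stated here): on every row carrying an `EMPTY` record of record —
`17127b1` (`EmptyRecordsThree01`, S0-CT3 Q1) and `15930u1 19656b1 13221g1 11286q1 6241a1`
(`EmptyRecordsThree02`, kit j139038, where ONLY the basis cubic `η₁` was run, A3 policy `one`) —
every OTHER non-zero class of `Ш[3]` (the cubics `η₂`, `η₁ ± η₂`) must also come back `EMPTY`
GIVEN the record's own inputs (`#Sel₃ = 9` EXACT, on file by three implementations, + CT). For
`17127b1` this is already observed: Fisher–Newton 2014 §4 print FOUR cubics `C₁ … C₄` (= the four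
non-zero classes of `Ш[3] ≅ (ℤ/3)²` up to sign) and B-1 found `C₁` EMPTY EXACT, `C₂ – C₄` EMPTY
(GRH) (eng-4 `b1/results/`); a future `η₂` run on the five `B1W` rows (≈ 90 s EXACT each on the
record) is a free falsification test of the record's exact inputs, not a new certificate.
(b) CORRECTION of scope (GEN 11 prose said 'MIXED contradicts the Cassels–Tate structure'): MIXED
contradicts CT **plus the exact count `#Ш[p] = p²`**. WITHOUT the count — the `hcard`-FREE
`NONEMPTY` regime of `ShaDivisibleFromTwoNonempty.lean` appendix A/B — MIXED is CONSISTENT: for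
`M = ℤ/9 ⊕ ℤ/3` the group `M × M` with its standard alternating perfect pairing has `#(M × M)[3] = 81`,
the class `((3,0),(0,0))` is a non-zero third multiple and `((0,1),(0,0))` is not. So at GRH grade
(front `dim Sel₃ = 2` under GRH, no `bnfcertify`) a MIXED pair refutes nothing in the kernel; it
says 'engine error OR the GRH-conditional class group missed Selmer elements' = ANOMALY to report,
never a certificate, exactly the lane's rule. The pairing hypothesis is also necessary:
`ℤ/9 ⊕ ℤ/3` has `#A[3] = 9` and mixed classes (and admits no alternating perfect pairing).
(c) The `NONEMPTY × 2` / `× 1` production rows of record (`19215t1`, `271726d1 405130d1 152330l1`,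
`210392t1 384400cx1`) each ran BOTH basis cubics and got `NONEMPTY` on both — consistent with the
law under their GRH-grade `dim Sel₃ = 2`.

References: B. Creutz, Math. Comp. 83 (2014) §1, §7 [Creutz2014]; J. H. Silverman, *AEC* X.4
[SilvermanAEC2009]; T. Fisher, R. Newton, LMS J. Comput. Math. 17 (2014) §4 [FisherNewton2014];
R. L. Miller 2011 §1 [Miller2011LMS].
-/

noncomputable section

open scoped Classical

open WeierstrassCurve NumberField Literature.NumberTheory.EllipticCurves
open Literature.NumberTheory.EllipticCurves.Rank1Residual
open Literature.NumberTheory.EllipticCurves.Rank1Residual.Typed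

namespace Summit.BirchSwinnertonDyer.Rank1Residual.SecondDescent

/-! ### §1. Algebra: divisibility by `p` is all-or-nothing on `A[p] ∖ {0}` -/

section Algebra

variable {A : Type*} [AddCommGroup A] {C : Type*} [AddCommGroup C]

/-- **All-or-nothing law.** In a finite abelian group `A` with an ALTERNATING bi-additive pairing
`B` of trivial (left) kernel and `#A[p] = p²`: if ONE `p`-torsion class `c` is not a `p`-th
multiple, then NO non-zero `p`-torsion class `c'` is a `p`-th multiple. (A witness `d`,
`p • d = c'`, would lie in `A[p²] = A[p]` by `nsmul_eq_zero_of_sq_nsmul_eq_zero_of_alternating`,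
forcing `c' = 0`.) -/
theorem not_divisible_of_not_divisible_of_alternating [Finite A] (B : A →+ A →+ C)
    (halt : ∀ x, B x x = 0) (hnd : ∀ x, (∀ y, B x y = 0) → x = 0) {p : ℕ} (hp : p.Prime)
    (hcard : Nat.card (AddSubgroup.torsionBy A (p : ℤ)) = p ^ 2) {c : A} (hpc : p • c = 0)
    (hndiv : ∀ d : A, p • d ≠ c) {c' : A} (hpc' : p • c' = 0) (hc' : c' ≠ 0) (d : A) :
    p • d ≠ c' := by
  intro hd
  have hd2 : p ^ 2 • d = 0 := by rw [pow_two, mul_nsmul', hd, hpc']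
  have h0 : p • d = 0 :=
    nsmul_eq_zero_of_sq_nsmul_eq_zero_of_alternating B halt hnd hp hcard hpc hndiv d hd2
  exact hc' (by rw [← hd]; exact h0)

/-- **Mixed verdicts are inconsistent.** Same hypotheses: an `EMPTY` class `c₂` (`p • c₂ = 0`, not a
`p`-th multiple) and a `NONEMPTY` class `c₁ ≠ 0` (`p • c₁ = 0`, `c₁ = p • d`) cannot coexist. -/
theorem false_of_mixed_of_alternating [Finite A] (B : A →+ A →+ C)
    (halt : ∀ x, B x x = 0) (hnd : ∀ x, (∀ y, B x y = 0) → x = 0) {p : ℕ} (hp : p.Prime)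
    (hcard : Nat.card (AddSubgroup.torsionBy A (p : ℤ)) = p ^ 2) {c₁ c₂ d : A}
    (h1 : p • c₁ = 0) (hc₁ : c₁ ≠ 0) (hd : p • d = c₁) (h2 : p • c₂ = 0)
    (hndiv : ∀ d' : A, p • d' ≠ c₂) : False :=
  not_divisible_of_not_divisible_of_alternating B halt hnd hp hcard h2 hndiv h1 hc₁ d hd

/-- The same law read as a subgroup statement: `A[p] ⊓ pA = ⊥` — every `p`-torsion `p`-th multiple
is zero. -/
theorem nsmul_eq_zero_of_nsmul_mem_torsionBy_of_alternating [Finite A] (B : A →+ A →+ C)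
    (halt : ∀ x, B x x = 0) (hnd : ∀ x, (∀ y, B x y = 0) → x = 0) {p : ℕ} (hp : p.Prime)
    (hcard : Nat.card (AddSubgroup.torsionBy A (p : ℤ)) = p ^ 2) {c : A} (hpc : p • c = 0)
    (hndiv : ∀ d : A, p • d ≠ c) (d : A) (hd : p • (p • d) = 0) : p • d = 0 := by
  by_contra h
  exact not_divisible_of_not_divisible_of_alternating B halt hnd hp hcard hpc hndiv hd h d rfl

end Algebra

/-! ### §2. `Ш(E/K)` with the Cassels–Tate pairing fact -/

section Sha

universe u

variable {K : Type u} [Field K] [NumberField K]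

/-- **All-or-nothing on `Ш[p]`.** For `E/K` with FINITE `Ш(E/K)`, the Cassels–Tate pairing fact
(`exists_casselsTate_pairing`, Silverman *AEC* X.4.14), an EXACT count `#Ш[p] = p²` and ONE class
`c ∈ Ш[p]` that is not a `p`-th multiple (a second-descent `EMPTY` certificate): NO non-zero class
`c' ∈ Ш[p]` is a `p`-th multiple — every other torsor of the `p`-descent must also be `EMPTY`.
Certificate-shaped hypotheses; nothing about any particular curve is asserted.
[cite: SilvermanAEC2009, Thm. X.4.14] [cite: Creutz2014, §1] -/
theorem _root_.WeierstrassCurve.sha_not_divisible_of_casselsTate_of_not_divisible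
    (h : exists_casselsTate_pairing (K := K)) (W : WeierstrassCurve K) [W.IsElliptic]
    [Finite W.sha] {p : ℕ} (hp : p.Prime)
    (hcard : Nat.card (AddSubgroup.torsionBy W.sha (p : ℤ)) = p ^ 2) {c : W.sha}
    (hpc : p • c = 0) (hndiv : ∀ d : W.sha, p • d ≠ c) {c' : W.sha} (hpc' : p • c' = 0)
    (hc' : c' ≠ 0) (d : W.sha) : p • d ≠ c' := by
  obtain ⟨B, halt, hker⟩ := h W
  refine not_divisible_of_not_divisible_of_alternating B halt (fun a ha => ?_) hp hcard hpc hndiv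
    hpc' hc' d
  have hmem : a ∈ AddSubgroup.divisibleElements W.sha := (hker a).mp ha
  rwa [divisibleElements_eq_bot_of_finite, AddSubgroup.mem_bot] at hmem

/-- **MIXED second-descent verdicts on `Ш[p]` are inconsistent given `#Ш[p] = p²` and CT**: an
`EMPTY` class `c₂` and a `NONEMPTY` class `c₁ ≠ 0` (witness `d`, `p • d = c₁`) give `False`.
[cite: SilvermanAEC2009, Thm. X.4.14] [cite: Creutz2014, §1] -/
theorem _root_.WeierstrassCurve.false_of_sha_mixed_of_casselsTate
    (h : exists_casselsTate_pairing (K := K)) (W : WeierstrassCurve K) [W.IsElliptic]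
    [Finite W.sha] {p : ℕ} (hp : p.Prime)
    (hcard : Nat.card (AddSubgroup.torsionBy W.sha (p : ℤ)) = p ^ 2) {c₁ c₂ d : W.sha}
    (h1 : p • c₁ = 0) (hc₁ : c₁ ≠ 0) (hd : p • d = c₁) (h2 : p • c₂ = 0)
    (hndiv : ∀ d' : W.sha, p • d' ≠ c₂) : False :=
  sha_not_divisible_of_casselsTate_of_not_divisible h W hp hcard h2 hndiv h1 hc₁ d hd

end Sha

/-! ### §3. `E/ℚ`, analytic rank `≤ 1`: the law in the `EMPTY` consumers' exact binders -/

section Rat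

variable (W : WeierstrassCurve ℚ) [W.IsElliptic] (p : ℕ) [hp : Fact p.Prime]

/-- **Every non-zero class of `Ш[p]` is `EMPTY` as soon as one is** — in the binders of
`bsdp_of_card_selmer_of_casselsTate_of_not_divisible`: GZK (`hGZK`: rank `= r_an`, `Ш` finite),
CT (`hCT`), `#E(ℚ)[p] = b > 0`, ONE complete descent `#Sel^(p)(E/ℚ) = p^(r_an) · b · p²` (so
`#Ш[p] = p²`, `card_torsionBy_sha_eq_of_card_selmerGroup`), ONE `EMPTY` class `c₂`. Conclusion: no
witness `d` with `p • d = c₁` exists for any non-zero `c₁ ∈ Ш[p]`. Per pair; a consistency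
statement; nothing booked. [cite: SilvermanAEC2009, Thm. X.4.2(a) and Thm. X.4.14]
[cite: Creutz2014, §1] -/
theorem sha_forall_not_divisible_of_card_selmer_of_casselsTate_of_not_divisible
    (hGZK : rank_eq_analyticRank_of_analyticRank_le_one)
    (hCT : exists_casselsTate_pairing (K := ℚ)) (hr : W.analyticRank ≤ 1) {b : ℕ}
    (htors : Nat.card (AddSubgroup.torsionBy W.toAffine.Point (p : ℤ)) = b) (hb : 0 < b)
    (hSel : Nat.card (W.selmerGroup (p : ℤ)) = p ^ W.analyticRank * b * p ^ 2)
    {c₂ : W.sha} (h2 : p • c₂ = 0) (hndiv : ∀ d' : W.sha, p • d' ≠ c₂)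
    {c₁ : W.sha} (h1 : p • c₁ = 0) (hc₁ : c₁ ≠ 0) (d : W.sha) : p • d ≠ c₁ := by
  obtain ⟨hrank, hfin⟩ := hGZK W hr
  haveI : Finite W.sha := hfin
  -- transport the computable `DecidableEq ℚ` of the binder to the classical one (as in
  -- `BSDpFromSecondDescentEmpty.lean`)
  have hinst : (instDecidableEqRat : DecidableEq ℚ) = fun a b => Classical.propDecidable (a = b) :=
    Subsingleton.elim _ _
  have htors' := htors
  rw [hinst] at htors'
  have hcard : Nat.card (AddSubgroup.torsionBy W.sha (p : ℕ)) = p ^ 2 :=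
    card_torsionBy_sha_eq_of_card_selmerGroup W p (a := p ^ W.analyticRank * b)
      (by rw [hrank, htors']) (Nat.mul_pos (pow_pos hp.out.pos _) hb) hSel
  exact sha_not_divisible_of_casselsTate_of_not_divisible hCT W hp.out hcard h2 hndiv h1 hc₁ d

/-- **MIXED verdicts ⇒ `False`** in the same binders: ONE `EMPTY` class `c₂` and ONE `NONEMPTY`
class `c₁ ≠ 0` (witness `d`, `p • d = c₁`) together with GZK + CT + `#E(ℚ)[p] = b` + the complete
descent count are contradictory. (This is the instrument's anomaly rule as a kernel statement: given
the EXACT `#Sel^(p)`, a mixed pair means an engine error, not arithmetic.)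
[cite: SilvermanAEC2009, Thm. X.4.2(a) and Thm. X.4.14] [cite: Creutz2014, §1] -/
theorem false_of_card_selmer_of_casselsTate_of_mixed
    (hGZK : rank_eq_analyticRank_of_analyticRank_le_one)
    (hCT : exists_casselsTate_pairing (K := ℚ)) (hr : W.analyticRank ≤ 1) {b : ℕ}
    (htors : Nat.card (AddSubgroup.torsionBy W.toAffine.Point (p : ℤ)) = b) (hb : 0 < b)
    (hSel : Nat.card (W.selmerGroup (p : ℤ)) = p ^ W.analyticRank * b * p ^ 2)
    {c₁ c₂ d : W.sha} (h1 : p • c₁ = 0) (hc₁ : c₁ ≠ 0) (hd : p • d = c₁) (h2 : p • c₂ = 0)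
    (hndiv : ∀ d' : W.sha, p • d' ≠ c₂) : False :=
  sha_forall_not_divisible_of_card_selmer_of_casselsTate_of_not_divisible W p hGZK hCT hr htors hb
    hSel h2 hndiv h1 hc₁ d hd

/-- **The same with `#E(ℚ)[p] = 1` discharged by irreducibility of `E[p]`** (Mazur 1977 p. 157,
tree `natCard_torsionBy_eq_one_of_hasIrreducibleModPGaloisRep`): GZK + CT + irr(`p`) +
`#Sel^(p)(E/ℚ) = p^(r_an + 2)` + ONE `EMPTY` class + ONE non-zero `NONEMPTY` class ⇒ `False`.
[cite: Mazur1977, Ch. III §5, p. 157] [cite: SilvermanAEC2009, Thm. X.4.2(a) and Thm. X.4.14] -/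
theorem false_of_irr_of_card_selmer_of_casselsTate_of_mixed
    (hGZK : rank_eq_analyticRank_of_analyticRank_le_one)
    (hCT : exists_casselsTate_pairing (K := ℚ)) (hr : W.analyticRank ≤ 1) (hirr : Irr W p)
    (hSel : Nat.card (W.selmerGroup (p : ℤ)) = p ^ (W.analyticRank + 2))
    {c₁ c₂ d : W.sha} (h1 : p • c₁ = 0) (hc₁ : c₁ ≠ 0) (hd : p • d = c₁) (h2 : p • c₂ = 0)
    (hndiv : ∀ d' : W.sha, p • d' ≠ c₂) : False :=
  false_of_card_selmer_of_casselsTate_of_mixed W p hGZK hCT hr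
    (natCard_torsionBy_eq_one_of_hasIrreducibleModPGaloisRep W p hirr) Nat.one_pos
    (by rw [hSel, pow_add, mul_one]) h1 hc₁ hd h2 hndiv

end Rat

/-! ### §4. `p = 3`: the shapes of the record files -/

section Three

/-- **Rank ZERO, `p = 3`, `E[3]` irreducible, `#Sel^(3)(E/ℚ) = 9` EXACT** — exactly the binders
`hr / hirr / h3 / c, h3c, hndiv` of the `EMPTY` records `bsdp3_b1e_·` (`EmptyRecordsThree01–02`)
— plus ONE `NONEMPTY` witness (`c₁ ≠ 0`, `3 • c₁ = 0`, `3 • d = c₁`) ⇒ `False`. Reading: on a row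
with an `EMPTY` record every other non-zero class of `Ш[3]` is predicted `EMPTY`; a `NONEMPTY`
there is an engine error given the record's inputs. Per pair; nothing booked.
[cite: Mazur1977, Ch. III §5, p. 157] [cite: SilvermanAEC2009, Thm. X.4.2(a) and Thm. X.4.14]
[cite: Creutz2014, §1] -/
theorem Three.false_rankZero_of_card_selmerThree_eq_nine_of_casselsTate_of_mixed
    (hGZK : rank_eq_analyticRank_of_analyticRank_le_one)
    (hCT : exists_casselsTate_pairing (K := ℚ)) (W : WeierstrassCurve ℚ) [W.IsElliptic]
    (hr : W.analyticRank = 0) (hirr : Irr W 3) (h3 : Nat.card (W.selmerGroup (3 : ℤ)) = 9)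
    {c₁ c₂ d : W.sha} (h1 : 3 • c₁ = 0) (hc₁ : c₁ ≠ 0) (hd : 3 • d = c₁)
    (h2 : 3 • c₂ = 0) (hndiv : ∀ d' : W.sha, 3 • d' ≠ c₂) : False :=
  haveI : Fact (Nat.Prime 3) := ⟨Nat.prime_three⟩
  false_of_irr_of_card_selmer_of_casselsTate_of_mixed W 3 hGZK hCT (by rw [hr]; norm_num) hirr
    (by rw [hr, show ((3 : ℕ) : ℤ) = 3 by norm_num, h3]; norm_num) h1 hc₁ hd h2 hndiv

/-- **Rank ZERO, `p = 3`: every non-zero class of `Ш[3]` is `EMPTY` as soon as one is** (same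
binders as the `bsdp3_b1e_·` records; the falsifiable prediction for the un-run cubics `η₂`,
`η₁ ± η₂` of those rows). Per pair; nothing booked.
[cite: Mazur1977, Ch. III §5, p. 157] [cite: SilvermanAEC2009, Thm. X.4.2(a) and Thm. X.4.14]
[cite: Creutz2014, §1] -/
theorem Three.sha_forall_not_divisible_rankZero_of_card_selmerThree_eq_nine_of_casselsTate
    (hGZK : rank_eq_analyticRank_of_analyticRank_le_one)
    (hCT : exists_casselsTate_pairing (K := ℚ)) (W : WeierstrassCurve ℚ) [W.IsElliptic]
    (hr : W.analyticRank = 0) (hirr : Irr W 3) (h3 : Nat.card (W.selmerGroup (3 : ℤ)) = 9)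
    {c : W.sha} (h3c : 3 • c = 0) (hndiv : ∀ d : W.sha, 3 • d ≠ c)
    {c₁ : W.sha} (h1 : 3 • c₁ = 0) (hc₁ : c₁ ≠ 0) (d : W.sha) : 3 • d ≠ c₁ :=
  fun hd => Three.false_rankZero_of_card_selmerThree_eq_nine_of_casselsTate_of_mixed hGZK hCT W hr
    hirr h3 h1 hc₁ hd h3c hndiv

/-- **Rank ONE, X11 at `p = 3` (`IsX11Three W`), `#Sel^(3)(E/ℚ) = 27` EXACT** — the binders of
`Three.bsdp_three_of_card_selmerThree_eq_27_of_casselsTate_of_not_divisible` — plus ONE non-zero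
`NONEMPTY` class ⇒ `False`. Per pair; X11 ∧ `r = 1` ∧ `p = 3` stays CONSTRUCTION-SHAPED; nothing
booked. [cite: SilvermanAEC2009, Thm. X.4.2(a) and Thm. X.4.14] [cite: Creutz2014, §1] -/
theorem Three.false_of_isX11Three_of_card_selmerThree_eq_27_of_casselsTate_of_mixed
    (hGZK : rank_eq_analyticRank_of_analyticRank_le_one)
    (hCT : exists_casselsTate_pairing (K := ℚ)) (W : WeierstrassCurve ℚ) [W.IsElliptic]
    (hX : IsX11Three W) (h3 : Nat.card (W.selmerGroup (3 : ℤ)) = 27)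
    {c₁ c₂ d : W.sha} (h1 : 3 • c₁ = 0) (hc₁ : c₁ ≠ 0) (hd : 3 • d = c₁)
    (h2 : 3 • c₂ = 0) (hndiv : ∀ d' : W.sha, 3 • d' ≠ c₂) : False :=
  haveI : Fact (Nat.Prime 3) := ⟨Nat.prime_three⟩
  false_of_irr_of_card_selmer_of_casselsTate_of_mixed W 3 hGZK hCT hX.rank.le hX.irr
    (by rw [hX.rank, show ((3 : ℕ) : ℤ) = 3 by norm_num, h3]; norm_num) h1 hc₁ hd h2 hndiv

end Three

end Summit.BirchSwinnertonDyer.Rank1Residual.SecondDescent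

end
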